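import Literature.MathematicalPhysics.QuantumFieldTheory.Balaban1983to89.B9TorusCalculus
import Literature.MathematicalPhysics.QuantumFieldTheory.Balaban1983to89.B10StarCount
import HarnessLib

/-!
# Route `UnitScaleTilt`, crux K1 «MinimiserStabilityRegPr» (stmt-QuantumFields-19200), route-R E′ S3 K-form engine (DESIGN-S3-KFORM-ENGINE-g15 row R3′) — (T-G):
# THE COVARIANT GAUSS LAW OF A FINITE SITE SET WITH AN ARBITRARY TRANSPORT ASSIGNMENT — transporting the covariant divergence `D*_U B` of a bond field to a common
# frame by `x ↦ T_x` and summing over `S` gives (inflow through ∂S) − (outflow through ∂S) + the INTERIOR HOLONOMY DEFECT `Σ_{b ⊂ S} Ad(T_{b₋})(Ad(h_b) − 1)B_b`,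
# `h_b = T_{b₋}⁻¹·T_{b₊}·U_b⁻¹` — exact, any units, any `S`, any `T`

Cell `ym3-torus`, width seat `ym3-torus-px17` (gen 2; LOCATE-R3PRIME-COVFACEFLUX-px17g2.md §3, §0.7 (T-G)).  THEOREMS ONLY (0 `def`, 0 `sorry`); `--supports stmt-QuantumFields-19200`,
count-neutral.  YM₃ on T³ is a ladder rung (R3), not the Clay problem; nothing here claims a stub, the crux, d = 4 or the mass gap.

WHY.  The flat face-flux orthogonality of the ζ-row engine (✓ `Prop7FaceFluxLineMean.sum_faceLayer_mul_coarseGrad_eq_zero`) rests on Gauss' law: for `∂^*B = 0` the net flux of `B` out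
of every block vanishes.  Its covariant twin (row R3′) needs the values of `B` on the bonds of a block TRANSPORTED to one frame (`T_x` = the comb transport of record); then
`Σ_{x∈S} Ad(T_x)(D*_UB)(x)` still telescopes across every interior bond `b = (x, x+e_μ) ⊂ S`, but the two contributions `Ad(T_{x+e_μ}U_b⁻¹)B_b` and `Ad(T_x)B_b` agree only up to
the holonomy `h_b = T_x⁻¹T_{x+e_μ}U_b⁻¹` of the loop (frame → `x+e_μ` → back along `b` → frame): THIS is where the transport junk of R3′ is born (LOCATE §3 (G4)), and this file isolates it
as an exact identity with no estimate — any finite `S`, any transport assignment `T`, any unit-valued background `U` (`B9Eq39Adjoint` letters `R`, `covDstar`, `divB` on the torus shifts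
`torusT P i`).  The boundary terms are the inflow `Σ_{b₋∉S, b₊∈S} Ad(T_{b₊}U_b⁻¹)B_b` and the outflow `Σ_{b₋∈S, b₊∉S} Ad(T_{b₋})B_b` (for a block: the near and far face layers).

WHAT IS PROVED (ns `…Theorems.Prop7CovCombGauss`; `𝔸` any ring for §1–§2).
* §1 `R_finset_sum` (`R(u)` over a finite sum), `R_R_inv_mul` (the loop algebra `R(T_x)R(U⁻¹)X = R(T_{x−e_μ})R(h)X`).
* §2 ★★ `sum_R_divB_eq` — `Σ_{x∈S} R(T_x)(D*_UB)(x) = Σ_μ Σ_{x∈S, x−e_μ∈S} R(T_{x−e_μ})(R(h_{x,μ})B_μ(x−e_μ) − B_μ(x−e_μ)) + Σ_μ Σ_{x∈S, x−e_μ∉S} R(T_x U_μ(x−e_μ)⁻¹)B_μ(x−e_μ) − Σ_μ Σ_{x∈S, x+e_μ∉S} R(T_x)B_μ(x)`,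
  `h_{x,μ} = T_{x−e_μ}⁻¹·T_x·U_μ(x−e_μ)⁻¹` (interior bonds indexed by their endpoint `x`); ★ `outflow_eq_of_divB_eq_zero` — for `D*_UB = 0` on `S`: outflow = inflow + interior holonomy defect.
HONEST SCOPE.  Finite algebra (splitting sums by membership, one reindexing along `x ↦ x + e_μ`, `R(uv) = R(u)R(v)`); no estimate, no comb, no smallness; the Stokes bound of `h_b − 1`,
the face-layer reading of the boundary sums and the R3′ assembly are elsewhere.

References: T. Bałaban, CMP 99 (1985) 389–434 [Balaban1985BackgroundPropagators] ((3.3) p.390, (3.5) p.391, (3.8) p.392); CMP 95 (1984) 17–40 [Balaban1984PropagatorsI] ((1.21) p.21,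
Prop. 1.1 (1.90) p.33); CMP 98 (1985) 17–51 [Balaban1985Averaging] ((9) p.18, pp.24–25); CMP 102 (1985) 277–309 [Balaban1985Variational] (Prop. 7 p.299).
-/

set_option autoImplicit false

noncomputable section

open scoped BigOperators

namespace Summit.QuantumFields.YangMills.Theorems.Prop7CovCombGauss

open Literature.MathematicalPhysics.QuantumFieldTheory.Balaban1983to89
open Finset
open B9Eq39Adjoint (R R_add R_sub R_zero covDstar divB)
open B9TorusCalculus (torusT torusT_apply torusT_symm_apply)
open B10StarCount (shift_unshift unshift_shift shiftEquiv)

/-! ## §1 Algebra of the transport `R` -/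

section Algebra

variable {𝔸 : Type*} [Ring 𝔸]

/-- `R(u)` of a finite sum is the sum of the `R(u)`'s. [folklore] -/
theorem R_finset_sum {ι : Type*} (u : 𝔸ˣ) (s : Finset ι) (f : ι → 𝔸) : R u (∑ j ∈ s, f j) = ∑ j ∈ s, R u (f j) := by
  classical
  induction s using Finset.induction_on with
  | empty => simp
  | insert a s ha ih => rw [Finset.sum_insert ha, Finset.sum_insert ha, R_add, ih]

/-- THE LOOP ALGEBRA: `R(T′)R(U⁻¹)X = R(T)(R(T⁻¹T′U⁻¹)X)`. [folklore] [cite: Balaban1985BackgroundPropagators, (3.5) p.391] -/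
theorem R_R_inv_mul (T T' U : 𝔸ˣ) (X : 𝔸) : R T' (R U⁻¹ X) = R T (R (T⁻¹ * T' * U⁻¹) X) := by
  rw [← B9Eq39Adjoint.R_mul, ← B9Eq39Adjoint.R_mul, mul_assoc, mul_inv_cancel_left]

end Algebra

/-! ## §2 The covariant Gauss law on a finite site set -/

section Gauss

variable {P : Params} {i : ℕ} {𝔸 : Type*} [Ring 𝔸]

/-- ★★ **THE COVARIANT GAUSS LAW WITH AN ARBITRARY TRANSPORT ASSIGNMENT.**  For every finite site set `S`, transports `T : Site → 𝔸ˣ`, unit-valued background `U` and bond field `B`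
(`B_μ(x) = B(x, x+e_μ)`):
`Σ_{x∈S} R(T_x)(D*_UB)(x) = Σ_μ Σ_{x∈S, x−e_μ∈S} R(T_{x−e_μ})(R(h_{x,μ})B_μ(x−e_μ) − B_μ(x−e_μ)) + Σ_μ Σ_{x∈S, x−e_μ∉S} R(T_x·U_μ(x−e_μ)⁻¹)B_μ(x−e_μ) − Σ_μ Σ_{x∈S, x+e_μ∉S} R(T_x)B_μ(x)`
with the loop holonomy `h_{x,μ} = T_{x−e_μ}⁻¹·T_x·U_μ(x−e_μ)⁻¹` of the interior bond `(x−e_μ, x)` — interior holonomy defect + inflow − outflow, exactly.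
[cite: Balaban1985BackgroundPropagators, (3.8) p.392, (3.5) p.391; Balaban1984PropagatorsI, (1.21) p.21] -/
theorem sum_R_divB_eq (S : Finset (Site P i)) (T : Site P i → 𝔸ˣ) (U : Fin P.d → Site P i → 𝔸ˣ) (B : Fin P.d → Site P i → 𝔸) :
    ∑ x ∈ S, R (T x) (divB (torusT P i) U B x)
      = ∑ μ : Fin P.d, ∑ x ∈ S.filter (fun x => x.unshift μ ∈ S),
            R (T (x.unshift μ)) (R ((T (x.unshift μ))⁻¹ * T x * (U μ (x.unshift μ))⁻¹) (B μ (x.unshift μ)) - B μ (x.unshift μ))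
        + ∑ μ : Fin P.d, ∑ x ∈ S.filter (fun x => x.unshift μ ∉ S), R (T x * (U μ (x.unshift μ))⁻¹) (B μ (x.unshift μ))
        - ∑ μ : Fin P.d, ∑ x ∈ S.filter (fun x => x.shift μ ∉ S), R (T x) (B μ x) := by
  classical
  -- unfold the divergence and distribute `R(T x)` over the `μ`-sum
  have hdiv : ∀ x : Site P i, R (T x) (divB (torusT P i) U B x)
      = ∑ μ : Fin P.d, (R (T x) (R (U μ (x.unshift μ))⁻¹ (B μ (x.unshift μ))) - R (T x) (B μ x)) := by
    intro x
    rw [divB, R_finset_sum]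
    refine Finset.sum_congr rfl fun μ _ => ?_
    rw [covDstar, torusT_symm_apply, R_sub]
  simp only [hdiv]
  rw [Finset.sum_comm, ← Finset.sum_add_distrib, ← Finset.sum_sub_distrib]
  refine Finset.sum_congr rfl fun μ _ => ?_
  rw [Finset.sum_sub_distrib]
  -- `A`: the transported backward terms, split by `x − e_μ ∈ S`
  have hA : ∑ x ∈ S, R (T x) (R (U μ (x.unshift μ))⁻¹ (B μ (x.unshift μ)))
      = ∑ x ∈ S.filter (fun x => x.unshift μ ∈ S), R (T x) (R (U μ (x.unshift μ))⁻¹ (B μ (x.unshift μ)))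
        + ∑ x ∈ S.filter (fun x => x.unshift μ ∉ S), R (T x) (R (U μ (x.unshift μ))⁻¹ (B μ (x.unshift μ))) :=
    (Finset.sum_filter_add_sum_filter_not S (fun x => x.unshift μ ∈ S) _).symm
  -- `C`: the untransported forward terms, split by `x + e_μ ∈ S`, the first part re-indexed by `x ↦ x + e_μ`
  have hC : ∑ x ∈ S, R (T x) (B μ x)
      = ∑ x ∈ S.filter (fun x => x.unshift μ ∈ S), R (T (x.unshift μ)) (B μ (x.unshift μ))
        + ∑ x ∈ S.filter (fun x => x.shift μ ∉ S), R (T x) (B μ x) := by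
    rw [← Finset.sum_filter_add_sum_filter_not S (fun x => x.shift μ ∈ S)]
    congr 1
    refine Finset.sum_equiv (shiftEquiv μ) (fun x => ?_) (fun x _ => ?_)
    · simp only [Finset.mem_filter, shiftEquiv, Equiv.coe_fn_mk, unshift_shift]
      exact and_comm
    · simp only [shiftEquiv, Equiv.coe_fn_mk, unshift_shift]
  rw [hA, hC]
  -- the interior terms combine through the loop algebra
  have hint : ∑ x ∈ S.filter (fun x => x.unshift μ ∈ S), R (T x) (R (U μ (x.unshift μ))⁻¹ (B μ (x.unshift μ)))
      - ∑ x ∈ S.filter (fun x => x.unshift μ ∈ S), R (T (x.unshift μ)) (B μ (x.unshift μ))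
      = ∑ x ∈ S.filter (fun x => x.unshift μ ∈ S),
          R (T (x.unshift μ)) (R ((T (x.unshift μ))⁻¹ * T x * (U μ (x.unshift μ))⁻¹) (B μ (x.unshift μ)) - B μ (x.unshift μ)) := by
    rw [← Finset.sum_sub_distrib]
    refine Finset.sum_congr rfl fun x _ => ?_
    rw [R_sub, ← R_R_inv_mul]
  -- the inflow terms: `R(T x)R(U⁻¹) = R(T x · U⁻¹)`
  have hin : ∑ x ∈ S.filter (fun x => x.unshift μ ∉ S), R (T x) (R (U μ (x.unshift μ))⁻¹ (B μ (x.unshift μ)))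
      = ∑ x ∈ S.filter (fun x => x.unshift μ ∉ S), R (T x * (U μ (x.unshift μ))⁻¹) (B μ (x.unshift μ)) :=
    Finset.sum_congr rfl fun x _ => by rw [B9Eq39Adjoint.R_mul]
  rw [← hint, hin]
  abel

/-- ★ **GAUSS' LAW FOR A COVARIANTLY CO-CLOSED FIELD**: if `(D*_UB)(x) = 0` for every `x ∈ S`, the outflow equals the inflow plus the interior holonomy defect:
`Σ_μ Σ_{x∈S, x+e_μ∉S} R(T_x)B_μ(x) = Σ_μ Σ_{x∈S, x−e_μ∉S} R(T_xU_μ(x−e_μ)⁻¹)B_μ(x−e_μ) + Σ_μ Σ_{x∈S, x−e_μ∈S} R(T_{x−e_μ})(R(h_{x,μ})B_μ(x−e_μ) − B_μ(x−e_μ))`.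
(Flat, `T ≡ 1`, `U ≡ 1`: the net flux vanishes — ✓ `Prop7FaceFlux.faceFlux_coclosed`.) [cite: Balaban1984PropagatorsI, (1.21) p.21; Balaban1985BackgroundPropagators, (3.8) p.392] -/
theorem outflow_eq_of_divB_eq_zero (S : Finset (Site P i)) (T : Site P i → 𝔸ˣ) (U : Fin P.d → Site P i → 𝔸ˣ) (B : Fin P.d → Site P i → 𝔸)
    (hB : ∀ x ∈ S, divB (torusT P i) U B x = 0) :
    ∑ μ : Fin P.d, ∑ x ∈ S.filter (fun x => x.shift μ ∉ S), R (T x) (B μ x)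
      = ∑ μ : Fin P.d, ∑ x ∈ S.filter (fun x => x.unshift μ ∉ S), R (T x * (U μ (x.unshift μ))⁻¹) (B μ (x.unshift μ))
        + ∑ μ : Fin P.d, ∑ x ∈ S.filter (fun x => x.unshift μ ∈ S),
            R (T (x.unshift μ)) (R ((T (x.unshift μ))⁻¹ * T x * (U μ (x.unshift μ))⁻¹) (B μ (x.unshift μ)) - B μ (x.unshift μ)) := by
  have h := sum_R_divB_eq S T U B
  have h0 : ∑ x ∈ S, R (T x) (divB (torusT P i) U B x) = 0 :=
    Finset.sum_eq_zero fun x hx => by rw [hB x hx, R_zero]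
  -- `0 = INT + IN − OUT`
  rw [h0, eq_sub_iff_add_eq, zero_add] at h
  rw [h, add_comm]

end Gauss

end Summit.QuantumFields.YangMills.Theorems.Prop7CovCombGauss

end
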